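import Mathlib
import Summits.Ventures.PercRepro2.Defs
import Summits.Ventures.PercRepro2.Independence
import Summits.Ventures.PercRepro2.Harris
import Summits.Ventures.PercRepro2.Graph
import Summits.Ventures.PercRepro2.Exploration
import Summits.Ventures.PercRepro2.FourFunctions
import Summits.Ventures.PercRepro2.Induced
import Summits.Ventures.PercRepro2.Frontier

/-!
# The van den Berg–Kahn conditional correlation inequality (blind cell PercRepro2, p1)

Van den Berg–Kahn, *A correlation inequality for connection events in percolation*,
Ann. Probab. 29 (2001) 123–126, Theorem 1.2: for a fixed source `s` and vertex sets `A, B, X, Y`,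
with `Q_A = {s ↔ a ∀ a ∈ A}` and `R_X = {s ↮ x ∀ x ∈ X}`,

  `P(Q_A ∩ R_X) · P(Q_B ∩ R_Y) ≤ P(Q_{A∪B} ∩ R_{X∩Y}) · P(R_{X∪Y})`,

whose case `A = {a}, B = {b}, X = Y = {t}` is Theorem 1.1: conditionally on `s ↮ t`, the events
`s ↔ a` and `s ↔ b` are positively correlated.

This file is the *exemplar* of the exploration mechanism of the cell (PLAN.md §1, proofs/TOOLBOX.md §4):
induction on the vertex set `U` of the induced subgraph; if `Z = X ∩ Y = ∅` the inequality is Harris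
twice; otherwise explore the edges around `Z`: the frontier `S(ω)` (Frontier.lean) reduces every term
to percolation on `G[U ∖ Z]` with `S(ω)` added to the avoided set (`prob_QEvent_inter_REvent_union`),
and the four functions theorem on the lattice `Config E` (`weight` is log-modular,
FourFunctions.lean) combined with the induction hypothesis on `U ∖ Z` and the lattice properties
`S(ω ⊔ ω') = S(ω) ∪ S(ω')`, `S(ω ⊓ ω') ⊆ S(ω) ∩ S(ω')` closes the step. Unlike the paper, no
frontier product law and no conditional probabilities are needed: everything is a finite sum.
-/

namespace Summit.Ventures.PercRepro2

section VdBKahn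

variable {V : Type*} {E : Type*} [Fintype E] [DecidableEq E] [Fintype V] [DecidableEq V]
  {R : Type*} [CommRing R] [LinearOrder R] [IsStrictOrderedRing R]

omit [Fintype V] in
/-- The case `X ∩ Y = ∅` of van den Berg–Kahn: Harris' inequality applied twice. -/
lemma vdBK_induced_of_inter_eq_empty (p : E → R) (hp : IsProbVec p) (ends : E → Sym2 V) (s : V)
    (U A B X Y : Finset V) (hZ : X ∩ Y = ∅) :
    prob p (QEvent ends U s A ∩ REvent ends U s X) *
        prob p (QEvent ends U s B ∩ REvent ends U s Y) ≤
      prob p (QEvent ends U s (A ∪ B) ∩ REvent ends U s (X ∩ Y)) *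
        prob p (REvent ends U s (X ∪ Y)) := by
  rw [hZ, REvent_empty, Set.inter_univ, QEvent_union, REvent_union]
  have hQA := isUpperSet_QEvent ends U s A
  have hQB := isUpperSet_QEvent ends U s B
  have hRX := isLowerSet_REvent ends U s X
  have hRY := isLowerSet_REvent ends U s Y
  have h1 : prob p (QEvent ends U s A ∩ REvent ends U s X) ≤
      prob p (QEvent ends U s A) * prob p (REvent ends U s X) := by
    rw [Set.inter_comm, mul_comm]
    exact prob_inter_le_prob_mul_prob_of_isLowerSet hp hRX hQA
  have h2 : prob p (QEvent ends U s B ∩ REvent ends U s Y) ≤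
      prob p (QEvent ends U s B) * prob p (REvent ends U s Y) := by
    rw [Set.inter_comm, mul_comm]
    exact prob_inter_le_prob_mul_prob_of_isLowerSet hp hRY hQB
  have h3 := prob_mul_prob_le_prob_inter hp hQA hQB
  have h4 := prob_mul_prob_le_prob_inter_of_isLowerSet hp hRX hRY
  calc prob p (QEvent ends U s A ∩ REvent ends U s X) *
        prob p (QEvent ends U s B ∩ REvent ends U s Y)
      ≤ (prob p (QEvent ends U s A) * prob p (REvent ends U s X)) *
          (prob p (QEvent ends U s B) * prob p (REvent ends U s Y)) :=
        mul_le_mul h1 h2 (prob_nonneg hp _) (mul_nonneg (prob_nonneg hp _) (prob_nonneg hp _))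
    _ = (prob p (QEvent ends U s A) * prob p (QEvent ends U s B)) *
          (prob p (REvent ends U s X) * prob p (REvent ends U s Y)) := by ring
    _ ≤ prob p (QEvent ends U s A ∩ QEvent ends U s B) *
          prob p (REvent ends U s X ∩ REvent ends U s Y) :=
        mul_le_mul h3 h4 (mul_nonneg (prob_nonneg hp _) (prob_nonneg hp _)) (prob_nonneg hp _)

/-- **van den Berg–Kahn, Theorem 1.2, on induced subgraphs**: for every vertex set `U` and all
`A, B, X, Y` with `X, Y ⊆ U`,
`P(Q^U_A ∩ R^U_X) · P(Q^U_B ∩ R^U_Y) ≤ P(Q^U_{A∪B} ∩ R^U_{X∩Y}) · P(R^U_{X∪Y})`. -/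
theorem vdBK_induced (p : E → R) (hp : IsProbVec p) (ends : E → Sym2 V) (s : V) (U : Finset V) :
    ∀ A B X Y : Finset V, X ⊆ U → Y ⊆ U →
      prob p (QEvent ends U s A ∩ REvent ends U s X) *
          prob p (QEvent ends U s B ∩ REvent ends U s Y) ≤
        prob p (QEvent ends U s (A ∪ B) ∩ REvent ends U s (X ∩ Y)) *
          prob p (REvent ends U s (X ∪ Y)) := by
  induction U using Finset.strongInduction with
  | H U ih =>
  intro A B X Y hX hY
  by_cases hZ : X ∩ Y = ∅
  · exact vdBK_induced_of_inter_eq_empty p hp ends s U A B X Y hZ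
  -- the exploration step: `Z = X ∩ Y ≠ ∅`
  set Z := X ∩ Y with hZdef
  have hZX : Z ⊆ X := Finset.inter_subset_left
  have hZY : Z ⊆ Y := Finset.inter_subset_right
  have hZU : Z ⊆ U := hZX.trans hX
  by_cases hsZ : s ∈ Z
  · -- `s ∈ X`: the left side vanishes
    rw [REvent_eq_empty_of_mem ends U (hZX hsZ), Set.inter_empty, prob_empty, zero_mul]
    exact mul_nonneg (prob_nonneg hp _) (prob_nonneg hp _)
  have hU' : U \ Z ⊂ U := Finset.sdiff_ssubset hZU (Finset.nonempty_iff_ne_empty.2 hZ)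
  -- the four terms as sums over configurations (domain Markov identity)
  have e1 : prob p (QEvent ends U s A ∩ REvent ends U s X) =
      ∑ ω, weight p ω * prob p (QEvent ends (U \ Z) s A ∩
        REvent ends (U \ Z) s ((X \ Z) ∪ frontier ends U Z ω)) := by
    rw [← prob_QEvent_inter_REvent_union p ends hZU hsZ A (X \ Z),
      Finset.sdiff_union_of_subset hZX]
  have e2 : prob p (QEvent ends U s B ∩ REvent ends U s Y) =
      ∑ ω, weight p ω * prob p (QEvent ends (U \ Z) s B ∩
        REvent ends (U \ Z) s ((Y \ Z) ∪ frontier ends U Z ω)) := by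
    rw [← prob_QEvent_inter_REvent_union p ends hZU hsZ B (Y \ Z),
      Finset.sdiff_union_of_subset hZY]
  have e3 : prob p (QEvent ends U s (A ∪ B) ∩ REvent ends U s Z) =
      ∑ ω, weight p ω * prob p (QEvent ends (U \ Z) s (A ∪ B) ∩
        REvent ends (U \ Z) s (∅ ∪ frontier ends U Z ω)) := by
    rw [← prob_QEvent_inter_REvent_union p ends hZU hsZ (A ∪ B) ∅, Finset.empty_union]
  have e4 : prob p (REvent ends U s (X ∪ Y)) =
      ∑ ω, weight p ω * prob p (QEvent ends (U \ Z) s ∅ ∩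
        REvent ends (U \ Z) s (((X \ Z) ∪ (Y \ Z)) ∪ frontier ends U Z ω)) := by
    rw [← prob_QEvent_inter_REvent_union p ends hZU hsZ ∅ ((X \ Z) ∪ (Y \ Z)), QEvent_empty,
      Set.univ_inter, ← Finset.union_sdiff_distrib,
      Finset.sdiff_union_of_subset (hZX.trans Finset.subset_union_left)]
  rw [e1, e2, e3, e4]
  -- the four functions theorem on the lattice `Config E`
  refine four_functions_theorem_univ
    (fun ω => weight p ω * prob p (QEvent ends (U \ Z) s A ∩
      REvent ends (U \ Z) s ((X \ Z) ∪ frontier ends U Z ω)))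
    (fun ω => weight p ω * prob p (QEvent ends (U \ Z) s B ∩
      REvent ends (U \ Z) s ((Y \ Z) ∪ frontier ends U Z ω)))
    (fun ω => weight p ω * prob p (QEvent ends (U \ Z) s (A ∪ B) ∩
      REvent ends (U \ Z) s (∅ ∪ frontier ends U Z ω)))
    (fun ω => weight p ω * prob p (QEvent ends (U \ Z) s ∅ ∩
      REvent ends (U \ Z) s (((X \ Z) ∪ (Y \ Z)) ∪ frontier ends U Z ω)))
    (fun ω => mul_nonneg (weight_nonneg hp ω) (prob_nonneg hp _))
    (fun ω => mul_nonneg (weight_nonneg hp ω) (prob_nonneg hp _))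
    (fun ω => mul_nonneg (weight_nonneg hp ω) (prob_nonneg hp _))
    (fun ω => mul_nonneg (weight_nonneg hp ω) (prob_nonneg hp _)) ?_
  intro ω ω'
  -- induction hypothesis on `U ∖ Z` with the frontiers added to the avoided sets
  have hX'' : (X \ Z) ∪ frontier ends U Z ω ⊆ U \ Z :=
    Finset.union_subset (Finset.sdiff_subset_sdiff hX (le_refl Z)) (frontier_subset ω)
  have hY'' : (Y \ Z) ∪ frontier ends U Z ω' ⊆ U \ Z :=
    Finset.union_subset (Finset.sdiff_subset_sdiff hY (le_refl Z)) (frontier_subset ω')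
  have hIH := ih (U \ Z) hU' A B ((X \ Z) ∪ frontier ends U Z ω)
    ((Y \ Z) ∪ frontier ends U Z ω') hX'' hY''
  -- `S(ω ⊓ ω') ⊆ S(ω) ∩ S(ω') ⊆ X'' ∩ Y''`
  have h3 : prob p (QEvent ends (U \ Z) s (A ∪ B) ∩ REvent ends (U \ Z) s
      (((X \ Z) ∪ frontier ends U Z ω) ∩ ((Y \ Z) ∪ frontier ends U Z ω'))) ≤
      prob p (QEvent ends (U \ Z) s (A ∪ B) ∩
        REvent ends (U \ Z) s (∅ ∪ frontier ends U Z (ω ⊓ ω'))) := by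
    refine prob_mono hp (Set.inter_subset_inter_right _ (REvent_anti _ _ _ ?_))
    rw [Finset.empty_union]
    exact (frontier_inf_subset ω ω').trans
      (Finset.inter_subset_inter Finset.subset_union_right Finset.subset_union_right)
  -- `X'' ∪ Y'' = (X' ∪ Y') ∪ S(ω ⊔ ω')`
  have h4 : prob p (REvent ends (U \ Z) s
      (((X \ Z) ∪ frontier ends U Z ω) ∪ ((Y \ Z) ∪ frontier ends U Z ω'))) =
      prob p (QEvent ends (U \ Z) s ∅ ∩
        REvent ends (U \ Z) s (((X \ Z) ∪ (Y \ Z)) ∪ frontier ends U Z (ω ⊔ ω'))) := by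
    rw [QEvent_empty, Set.univ_inter, frontier_sup]
    congr 2
    ext x
    simp only [Finset.mem_union]
    tauto
  calc weight p ω * prob p (QEvent ends (U \ Z) s A ∩
          REvent ends (U \ Z) s ((X \ Z) ∪ frontier ends U Z ω)) *
        (weight p ω' * prob p (QEvent ends (U \ Z) s B ∩
          REvent ends (U \ Z) s ((Y \ Z) ∪ frontier ends U Z ω')))
      = (weight p ω * weight p ω') *
          (prob p (QEvent ends (U \ Z) s A ∩
            REvent ends (U \ Z) s ((X \ Z) ∪ frontier ends U Z ω)) *
          prob p (QEvent ends (U \ Z) s B ∩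
            REvent ends (U \ Z) s ((Y \ Z) ∪ frontier ends U Z ω'))) := by ring
    _ ≤ (weight p ω * weight p ω') *
          (prob p (QEvent ends (U \ Z) s (A ∪ B) ∩
            REvent ends (U \ Z) s (∅ ∪ frontier ends U Z (ω ⊓ ω'))) *
          prob p (QEvent ends (U \ Z) s ∅ ∩
            REvent ends (U \ Z) s (((X \ Z) ∪ (Y \ Z)) ∪ frontier ends U Z (ω ⊔ ω')))) :=
        mul_le_mul_of_nonneg_left
          (hIH.trans (mul_le_mul h3 (le_of_eq h4) (prob_nonneg hp _) (prob_nonneg hp _)))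
          (mul_nonneg (weight_nonneg hp ω) (weight_nonneg hp ω'))
    _ = weight p (ω ⊓ ω') * prob p (QEvent ends (U \ Z) s (A ∪ B) ∩
          REvent ends (U \ Z) s (∅ ∪ frontier ends U Z (ω ⊓ ω'))) *
        (weight p (ω ⊔ ω') * prob p (QEvent ends (U \ Z) s ∅ ∩
          REvent ends (U \ Z) s (((X \ Z) ∪ (Y \ Z)) ∪ frontier ends U Z (ω ⊔ ω')))) := by
        rw [← weight_inf_mul_weight_sup p ω ω']
        ring

end VdBKahn

/-! ## The theorem on the whole graph -/

section Whole

variable {V : Type*} {E : Type*} [Fintype E] [DecidableEq E] [Fintype V] [DecidableEq V]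
  {R : Type*} [CommRing R] [LinearOrder R] [IsStrictOrderedRing R]

omit [Fintype E] [DecidableEq E] [DecidableEq V] in
/-- `Q^{univ}_A` is the whole-graph event. -/
lemma QEvent_univ (ends : E → Sym2 V) (s : V) (A : Finset V) :
    QEvent ends Finset.univ s A = connAll ends s A := by
  ext ω
  simp only [mem_QEvent, connAll, Set.mem_setOf_eq, Finset.coe_univ, induced_univ]

omit [Fintype E] [DecidableEq E] [DecidableEq V] in
/-- `R^{univ}_X` is the whole-graph event. -/
lemma REvent_univ (ends : E → Sym2 V) (s : V) (X : Finset V) :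
    REvent ends Finset.univ s X = avoidAll ends s X := by
  ext ω
  simp only [mem_REvent, avoidAll, Set.mem_setOf_eq, Finset.coe_univ, induced_univ]

/-- **van den Berg–Kahn, Theorem 1.2** (Ann. Probab. 29 (2001), doi:10.1214/aop/1008956324):
for a source `s` and vertex sets `A, B, X, Y` of a finite graph,
`P(Q_A ∩ R_X) · P(Q_B ∩ R_Y) ≤ P(Q_{A∪B} ∩ R_{X∩Y}) · P(R_{X∪Y})`, where
`Q_A = {s ↔ a ∀ a ∈ A}` and `R_X = {s ↮ x ∀ x ∈ X}`. -/
theorem vdBK (p : E → R) (hp : IsProbVec p) (ends : E → Sym2 V) (s : V) (A B X Y : Finset V) :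
    prob p (connAll ends s A ∩ avoidAll ends s X) * prob p (connAll ends s B ∩ avoidAll ends s Y) ≤
      prob p (connAll ends s (A ∪ B) ∩ avoidAll ends s (X ∩ Y)) * prob p (avoidAll ends s (X ∪ Y)) := by
  have h := vdBK_induced p hp ends s Finset.univ A B X Y (Finset.subset_univ X)
    (Finset.subset_univ Y)
  simpa only [QEvent_univ, REvent_univ] using h

/-- **van den Berg–Kahn, Theorem 1.1** (conditional positive correlation of connection events
given an avoidance): `P(s↔a, s↔b, s↮t) · P(s↮t) ≥ P(s↔a, s↮t) · P(s↔b, s↮t)`, i.e.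
`P(s↔a, s↔b | s↮t) ≥ P(s↔a | s↮t) P(s↔b | s↮t)` whenever `P(s↮t) > 0`. -/
theorem vdBK_pair (p : E → R) (hp : IsProbVec p) (ends : E → Sym2 V) (s a b t : V) :
    prob p (connEvent ends s a ∩ (connEvent ends s t)ᶜ) *
        prob p (connEvent ends s b ∩ (connEvent ends s t)ᶜ) ≤
      prob p (connEvent ends s a ∩ connEvent ends s b ∩ (connEvent ends s t)ᶜ) *
        prob p (connEvent ends s t)ᶜ := by
  have h := vdBK p hp ends s {a} {b} {t} {t}
  have e1 : ∀ c : V, connAll ends s {c} = connEvent ends s c := by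
    intro c; ext ω; simp [connAll]
  have e2 : avoidAll ends s {t} = (connEvent ends s t)ᶜ := by
    ext ω; simp [avoidAll]
  have e3 : connAll ends s ({a} ∪ {b}) = connEvent ends s a ∩ connEvent ends s b := by
    ext ω; simp [connAll]
  simp only [Finset.inter_self, Finset.union_self, e1, e2, e3] at h
  exact h

end Whole

end Summit.Ventures.PercRepro2
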